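import Summits.QuantumFields.BalabanUV.T4Continuum.Support.ShellMeasureWilsonLedgerSource

/-!
# `T4Continuum.ShellMeasureWilsonLedgerWindow` — the level-0 faces UNDER END-I's LIVE WINDOW: the cutoff-uniformity
# binder `hD` of row S19 file 3 DISCHARGED (a finite window sum), the faces book NO shell weight beyond `K = N₁`, and two
# window-truncated slot ledgers close `ShellWeightBound` with NO rate and NO level majorant — kernel bookkeeping, no estimate
# (cell `pub-balaban`, sub-cell `t4`, spine estimate NE7c (node U5b); NE7c ROUND-2 crew seat
# `b2b-balaban-t4-ne7c-formalise-leaf-09` (gen 4), OFFER to the claim table `t4/b2b-balaban-t4-ne7c-p1/LEAVES-NE7c-P1.md`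
# (the owner t4-ne7c-p1 books ∕ renumbers ∕ refuses); ADDITIVE — imports row S19 file 2 `ShellMeasureWilsonLedgerSource`
# (p209573; hence row S17 `ShellMeasureRootCompositionPushCubes` p208728) only and modifies nothing; 0 `def`, 0 sorry,
# 0 citations)

HONEST FRAMING.  Finite four-torus programme, rung (B)+1 only — NOT infinite volume, NOT a mass gap, NOT the Clay
problem, NOT summit progress; (B), `BetaPertHyp`, (B^μ) are not consumed.  NE7c = `T4IndicatorShell.ShellWeightBound`
is NOT PRINTED in [Balaban 1983–89] and NOT PROVED; every result below reads «NE7c ⇐ the named binders» (trigger c3);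
a level-0 face is NOT NE7c ((M1)₀ realized ≠ NE7c).  HONEST DEPENDENCY (cell): continuum YM on T⁴ ⇐ BetaPertH ∧ nine
spine estimates (0/9 proved); BetaPertH ⇐ (D1) ∧ (D4) ∧ CAP+tail; G-an2-4 gates asym, D1 and NE2/3/4.

THE POINT (typer's T-NE7c-3 made kernel; referee pass 5's displayed item «`hD` cutoff-uniformity» removed).  END-I
(`T4ShellMeasureLevels.shellWeightBound_of_levels` ∕ `ShellMeasureRootComposition.shellWeightBound_of_slotAC`) consumes a
run's `LevelLedger` TOGETHER WITH its live window `LiveWindow S lvl N₁ ν̄`, whose field `recent : K ≤ lvl K s + N₁` reads,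
for the level-0 faces of rows S12∕S17∕S19 (`lvl ≡ 0`, slots `s ∈ C K`), `∀ K, ∀ s ∈ C K, K ≤ N₁` (`window_of_liveWindow`):
a level-0 slot is live at the cutoffs `K ≤ N₁` ONLY, and `C K = ∅` for `K > N₁` (`eq_empty_of_window`).  Consequently
* the UNIFORMITY-IN-THE-CUTOFF binder of row S19 file 3 (`ShellMeasureWilsonLedgerFamily.levelLedger_wilson_su2_levelZero_family`,
  `hD : ∀ K s, 2(n_{K,s} + β_K·#P_w·8S_K(8+32S_K))∕(1−δ)·e^{2l₀w} ≤ D 0` — displayed there as «SM-L10 at level 0», and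
  read there as coupling the chart window `S_K` to the bare coupling `β_K` along the whole cutoff family) is, under the
  window END-I imposes anyway, a bound over the FINITELY MANY live pairs `(K, s)`, `K ≤ N₁`, `s ∈ C K`; it is DISCHARGED by
  the explicit WINDOW SUM `Σ_{K ≤ N₁} Σ_{s ∈ C K} D_{K,s}` (`slotConst_le_windowSum`, all `D_{K,s} ≥ 0`): §3
  `levelLedger_wilson_su2_levelZero_family_window` = row S19 file 3's theorem with `hD`∕`hD0` REMOVED, `hwin` ADDED, and the
  ledger's level constant THE window sum — no coupling-scaled window is needed for it (the `K → ∞` behaviour of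
  `β_K S_K` is never met by a level-0 slot);
* the level-0 faces book the relative shell weight `ω K = #(C K)·W·ρ₀` at `K ≤ N₁` and `ω K = 0` beyond
  (`omega_levelZero_cubes_window_eq_zero`): two window-truncated slot ledgers close `T4IndicatorShell.ShellWeightBound`
  LITERALLY, with `Wsh` of finite support, NO (F∞)-rate and NO level majorant `D̄` (`shellWeightBound_of_slotLedger_window`,
  `shellWeightBound_levelZero_window`) — a DEGENERATE closure that exhibits exactly why the level-0 faces are not NE7c:
  the content of NE7c sits at the live levels `j ≥ 1` (END-II and its binders SM-L1…L6, U1b's rate), which these faces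
  do not carry.
Nothing printed is asserted; [folklore] composition BY NAME of `ShellMeasureRootCompositionPushCubes.levelLedger_levelZero_cubes`,
`ShellMeasureWilsonLedgerSource.slotAntiConcentration_wilson_su2_gibbs_source`, `T4ShellMeasureFibre.slotAntiConcentration_mono`,
`T4ShellMeasure.SlotLedger.sum_sh_le`.

## What is proved ([folklore])

§1 window arithmetic: `eq_empty_of_window`, `window_of_liveWindow`, `liveWindow_levelZero_of_count` (END-I's `LiveWindow`
at `lvl ≡ 0` ⇐ the window + a slot count), `windowSum_nonneg`, `slotConst_le_windowSum`, `slotAC_window_of_slotConst`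
((M1) per live slot with SLOT constants ⇒ (M1) with the one window constant).
§2 generic level 0: `levelLedger_levelZero_cubes_window` (row S17's plug with slot constants under the window),
`omega_levelZero_cubes_window`, `omega_levelZero_cubes_window_eq_zero`, `shellWeightBound_of_slotLedger_window` (any two
slot ledgers whose `ω` vanish beyond `N₁` close R0), `shellWeightBound_levelZero_window` (two level-0 cube faces on common
cubes, conclusion LITERALLY `ShellWeightBound l₀ T A B shA shB Wsh` with the explicit finitely supported `Wsh`).
§3 realized `SU(2)`: `levelLedger_wilson_su2_levelZero_family_window` (row S19 file 3 without `hD`).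

WHAT THIS DOES NOT DO.  No live level `j ≥ 1`, no END-II binder touched (SM-L1…L8 displayed as before), the level-0
closeness `|wilsonU − u^B| ≤ ρ₀θ₀` (node U1b TYPE) and the slot count stay displayed; NE7c NOT proved; 0/9 spine.
-/

noncomputable section

open Set Function MeasureTheory Finset

namespace Summit.QuantumFields.BalabanUV.T4Continuum.ShellMeasureWilsonLedgerWindow

open scoped ENNReal
open Literature.MathematicalPhysics.QuantumFieldTheory.Balaban1983to89
open T4IndicatorShell (ShellWeightBound)
open T4ShellMeasure (SlotAntiConcentration SlotLedger)
open T4ShellMeasureLevels (LevelLedger LiveWindow)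
open T4CubeChartGnomonic (SU2)
open T4AxialGaugeFixing (combBonds)
open T4AxialGaugeSmallField (boxPlaqs boxBonds)
open ShellMeasureWilsonRealizedSU2 (wilsonU measurable_wilsonU wilsonSum_nonneg)
open ShellMeasureRootCompositionPushCubes (regionWeight regionShell regionPiece levelLedger_levelZero_cubes
  omega_levelZero_cubes)
open ShellMeasureWilsonLedgerSource (slotAntiConcentration_wilson_su2_gibbs_source)

/-! ## §1 Window arithmetic at level 0 -/

section Window

variable {σ : Type*} {C : ℕ → Finset σ} {N₁ : ℕ}

/-- under the level-0 window `∀ K, ∀ s ∈ C K, K ≤ N₁` there is NO level-0 slot beyond the cutoff `N₁`. [folklore] -/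
theorem eq_empty_of_window (hwin : ∀ K, ∀ s ∈ C K, K ≤ N₁) {K : ℕ} (hK : N₁ < K) : C K = ∅ :=
  Finset.eq_empty_of_forall_notMem fun s hs => absurd (hwin K s hs) (not_le.2 hK)

/-- END-I's `LiveWindow` at `lvl ≡ 0` (field `recent`) IS the level-0 window `∀ K, ∀ s ∈ C K, K ≤ N₁`. [folklore] -/
theorem window_of_liveWindow {νbar : ℝ} (hw : LiveWindow C (fun _ _ => 0) N₁ νbar) : ∀ K, ∀ s ∈ C K, K ≤ N₁ :=
  fun K s hs => by simpa using hw.recent K s hs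

/-- conversely, the level-0 window and a slot count `#(C K) ≤ ν̄` give END-I's `LiveWindow` at `lvl ≡ 0`. [folklore] -/
theorem liveWindow_levelZero_of_count {νbar : ℝ} (hwin : ∀ K, ∀ s ∈ C K, K ≤ N₁)
    (hcount : ∀ K, ((C K).card : ℝ) ≤ νbar) : LiveWindow C (fun _ _ => 0) N₁ νbar where
  recent K s hs := by simpa using hwin K s hs
  le_top K _ _ := Nat.zero_le K
  count K j := le_trans (by exact_mod_cast Finset.card_le_card (Finset.filter_subset _ (C K))) (hcount K)

/-- the WINDOW SUM `Σ_{K ≤ N₁} Σ_{s ∈ C K} D_{K,s}` of nonnegative slot constants is nonnegative. [folklore] -/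
theorem windowSum_nonneg {Dslot : ℕ → σ → ℝ} (hDs : ∀ K, ∀ s ∈ C K, 0 ≤ Dslot K s) :
    0 ≤ ∑ K' ∈ Finset.range (N₁ + 1), ∑ s' ∈ C K', Dslot K' s' :=
  Finset.sum_nonneg fun K' _ => Finset.sum_nonneg (hDs K')

/-- every live slot constant is below the window sum. [folklore] -/
theorem slotConst_le_windowSum {Dslot : ℕ → σ → ℝ} (hDs : ∀ K, ∀ s ∈ C K, 0 ≤ Dslot K s) {K : ℕ} (hK : K ≤ N₁)
    {s : σ} (hs : s ∈ C K) : Dslot K s ≤ ∑ K' ∈ Finset.range (N₁ + 1), ∑ s' ∈ C K', Dslot K' s' :=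
  calc Dslot K s ≤ ∑ s' ∈ C K, Dslot K s' := Finset.single_le_sum (hDs K) hs
    _ ≤ ∑ K' ∈ Finset.range (N₁ + 1), ∑ s' ∈ C K', Dslot K' s' :=
      Finset.single_le_sum (f := fun K' => ∑ s' ∈ C K', Dslot K' s') (fun K' _ => Finset.sum_nonneg (hDs K'))
        (Finset.mem_range.2 (Nat.lt_succ_of_le hK))

/-- **(M1) PER LIVE SLOT WITH SLOT CONSTANTS ⇒ (M1) WITH THE ONE WINDOW CONSTANT** (under the level-0 window;
`T4ShellMeasureFibre.slotAntiConcentration_mono`). [folklore] -/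
theorem slotAC_window_of_slotConst {Ω : ℕ → Type*} [∀ K, MeasurableSpace (Ω K)] {μ : ∀ K : ℕ, ℝ → Measure (Ω K)}
    {u : ∀ K : ℕ, ℝ → σ → Ω K → ℝ} {θ₀ ρ₀ l₀ : ℝ} {Dslot : ℕ → σ → ℝ} (hρ : 0 ≤ ρ₀)
    (hDs : ∀ K, ∀ s ∈ C K, 0 ≤ Dslot K s) (hwin : ∀ K, ∀ s ∈ C K, K ≤ N₁)
    (hac : ∀ K t, |t| ≤ l₀ → ∀ s ∈ C K, SlotAntiConcentration (μ K t) (u K t s) θ₀ ρ₀ (Dslot K s)) :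
    ∀ K t, |t| ≤ l₀ → ∀ s ∈ C K, SlotAntiConcentration (μ K t) (u K t s) θ₀ ρ₀
      (∑ K' ∈ Finset.range (N₁ + 1), ∑ s' ∈ C K', Dslot K' s') := fun K t ht s hs =>
  T4ShellMeasureFibre.slotAntiConcentration_mono hρ (slotConst_le_windowSum hDs (hwin K s hs) hs) (hac K t ht s hs)

end Window

/-! ## §2 Level 0 under the window: the ledger with slot constants, its weight, and the window-truncated END -/

section LevelZero

variable {Ω : ℕ → Type*} [∀ K, MeasurableSpace (Ω K)] {σ : Type*} [DecidableEq σ] {C : ℕ → Finset σ} {N₁ : ℕ}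
  {l₀ : ℝ}

/-- **LEVEL 0, FULL CUBE PARTITION, UNDER THE WINDOW: `LevelLedger` ⇐ (M1)₀ PER LIVE SLOT WITH SLOT CONSTANTS.**  Row S17's
`levelLedger_levelZero_cubes` with the per-slot wall `hac` carrying SLOT constants `D_{K,s} ≥ 0` and the level-0 window
`∀ K, ∀ s ∈ C K, K ≤ N₁` (END-I's `LiveWindow.recent` at `lvl ≡ 0`); the ledger's level constant is THE WINDOW SUM
`Σ_{K ≤ N₁} Σ_{s ∈ C K} D_{K,s}` (constant in the level index — only level `0` is ever read).  CONDITIONAL on `hac` and the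
a.e. closeness; nothing printed asserted. [folklore] -/
theorem levelLedger_levelZero_cubes_window {μ : ∀ K : ℕ, ℝ → Measure (Ω K)} [∀ K t, IsFiniteMeasure (μ K t)]
    {uA uB : ∀ K : ℕ, ℝ → σ → Ω K → ℝ} {θ ρ : ℕ → ℝ} {Dslot : ℕ → σ → ℝ}
    (huA : ∀ K t s, Measurable (uA K t s)) (huB : ∀ K t s, Measurable (uB K t s))
    (hclose : ∀ K t, |t| ≤ l₀ → ∀ s ∈ C K, ∀ᵐ ω ∂(μ K t), |uA K t s ω - uB K t s ω| ≤ ρ 0 * θ 0)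
    (hρ : ∀ j, 0 ≤ ρ j) (hDs : ∀ K, ∀ s ∈ C K, 0 ≤ Dslot K s) (hwin : ∀ K, ∀ s ∈ C K, K ≤ N₁)
    (hac : ∀ K t, |t| ≤ l₀ → ∀ s ∈ C K, SlotAntiConcentration (μ K t) (uA K t s) (θ 0) (ρ 0) (Dslot K s)) :
    LevelLedger l₀ (fun K => (C K).powerset) (fun K t => regionWeight (C K) (μ K t) (uA K t) (θ 0))
      (fun K t => regionShell (C K) (μ K t) (uA K t) (uB K t) (θ 0)) C
      (fun K t => regionPiece (C K) (μ K t) (uA K t) (uB K t) (θ 0)) (fun _ _ => 0)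
      (fun _ => ∑ K' ∈ Finset.range (N₁ + 1), ∑ s' ∈ C K', Dslot K' s') ρ :=
  levelLedger_levelZero_cubes huA huB hclose (fun _ => windowSum_nonneg hDs) hρ
    (slotAC_window_of_slotConst (hρ 0) hDs hwin hac)

/-- the relative shell weight this ledger books at cutoff `K`: `ω K = #(C K) · (W · ρ₀)` with `W` the window sum.
[folklore] -/
theorem omega_levelZero_cubes_window {μ : ∀ K : ℕ, ℝ → Measure (Ω K)} [∀ K t, IsFiniteMeasure (μ K t)]
    {uA uB : ∀ K : ℕ, ℝ → σ → Ω K → ℝ} {θ ρ : ℕ → ℝ} {Dslot : ℕ → σ → ℝ}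
    (huA : ∀ K t s, Measurable (uA K t s)) (huB : ∀ K t s, Measurable (uB K t s))
    (hclose : ∀ K t, |t| ≤ l₀ → ∀ s ∈ C K, ∀ᵐ ω ∂(μ K t), |uA K t s ω - uB K t s ω| ≤ ρ 0 * θ 0)
    (hρ : ∀ j, 0 ≤ ρ j) (hDs : ∀ K, ∀ s ∈ C K, 0 ≤ Dslot K s) (hwin : ∀ K, ∀ s ∈ C K, K ≤ N₁)
    (hac : ∀ K t, |t| ≤ l₀ → ∀ s ∈ C K, SlotAntiConcentration (μ K t) (uA K t s) (θ 0) (ρ 0) (Dslot K s))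
    (K : ℕ) :
    (levelLedger_levelZero_cubes_window huA huB hclose hρ hDs hwin hac).toSlotLedger.omega K =
      (C K).card * ((∑ K' ∈ Finset.range (N₁ + 1), ∑ s' ∈ C K', Dslot K' s') * ρ 0) :=
  omega_levelZero_cubes huA huB hclose (fun _ => windowSum_nonneg hDs) hρ (slotAC_window_of_slotConst (hρ 0) hDs hwin hac) K

/-- **THE LEVEL-0 FACE BOOKS NO SHELL WEIGHT BEYOND THE WINDOW**: `ω K = 0` for `K > N₁` (no live level-0 slot there —
typer's T-NE7c-3). [folklore] -/
theorem omega_levelZero_cubes_window_eq_zero {μ : ∀ K : ℕ, ℝ → Measure (Ω K)} [∀ K t, IsFiniteMeasure (μ K t)]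
    {uA uB : ∀ K : ℕ, ℝ → σ → Ω K → ℝ} {θ ρ : ℕ → ℝ} {Dslot : ℕ → σ → ℝ}
    (huA : ∀ K t s, Measurable (uA K t s)) (huB : ∀ K t s, Measurable (uB K t s))
    (hclose : ∀ K t, |t| ≤ l₀ → ∀ s ∈ C K, ∀ᵐ ω ∂(μ K t), |uA K t s ω - uB K t s ω| ≤ ρ 0 * θ 0)
    (hρ : ∀ j, 0 ≤ ρ j) (hDs : ∀ K, ∀ s ∈ C K, 0 ≤ Dslot K s) (hwin : ∀ K, ∀ s ∈ C K, K ≤ N₁)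
    (hac : ∀ K t, |t| ≤ l₀ → ∀ s ∈ C K, SlotAntiConcentration (μ K t) (uA K t s) (θ 0) (ρ 0) (Dslot K s))
    {K : ℕ} (hK : N₁ < K) :
    (levelLedger_levelZero_cubes_window huA huB hclose hρ hDs hwin hac).toSlotLedger.omega K = 0 := by
  rw [omega_levelZero_cubes_window huA huB hclose hρ hDs hwin hac K, eq_empty_of_window hwin hK, Finset.card_empty,
    Nat.cast_zero, zero_mul]

/-- **THE WINDOW-TRUNCATED END (generic).**  Two slot ledgers (`T4ShellMeasure.SlotLedger`) of the two runs on a common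
term family whose relative shell weights VANISH beyond a cutoff `N₁` close `T4IndicatorShell.ShellWeightBound` LITERALLY,
with `Wsh K = ω^A K + ω^B K` of finite support — NO (F∞)-rate, NO level majorant.  DEGENERATE by design: END-I's live
levels `j ≥ 1` are absent. [folklore] -/
theorem shellWeightBound_of_slotLedger_window {ι σA σB : Type*} {T : ℕ → Finset ι} {A B shA shB : ℕ → ℝ → ι → ℝ}
    {SA : ℕ → Finset σA} {SB : ℕ → Finset σB} {pieceA : ℕ → ℝ → σA → ι → ℝ} {pieceB : ℕ → ℝ → σB → ι → ℝ}
    {cA : ℕ → σA → ℝ} {cB : ℕ → σB → ℝ} (hA : SlotLedger l₀ T A shA SA pieceA cA)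
    (hB : SlotLedger l₀ T B shB SB pieceB cB) (hωA : ∀ K, N₁ < K → hA.omega K = 0)
    (hωB : ∀ K, N₁ < K → hB.omega K = 0) :
    ShellWeightBound l₀ T A B shA shB (fun K => hA.omega K + hB.omega K) where
  nonneg K := add_nonneg (hA.omega_nonneg K) (hB.omega_nonneg K)
  summable := summable_of_ne_finset_zero (s := Finset.range (N₁ + 1)) fun K hK => by
    have hK' : N₁ < K := not_le.1 fun h => hK (Finset.mem_range.2 (Nat.lt_succ_of_le h))
    rw [hωA K hK', hωB K hK', add_zero]
  sh_nonneg_left := hA.sh_nonneg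
  sh_le_left := hA.sh_le
  sh_nonneg_right := hB.sh_nonneg
  sh_le_right := hB.sh_le
  left K _ ht := by
    have h := hA.sum_sh_le K ht
    have hZ := hA.sum_A_nonneg K ht
    nlinarith [hB.omega_nonneg K]
  right K _ ht := by
    have h := hB.sum_sh_le K ht
    have hZ := hB.sum_A_nonneg K ht
    nlinarith [hA.omega_nonneg K]

/-- **TWO LEVEL-0 CUBE FACES UNDER THE WINDOW CLOSE R0 — DEGENERATELY.**  Run A (realized measures `μ^A K t`, tested
variables `u^A`, closeness to `u^B` under `μ^A`, (M1)₀ per live slot with slot constants `D^A_{K,s}`) and run B (the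
same with the roles of `u^A`, `u^B` exchanged, under its own measures `μ^B K t`), on the COMMON cube family `C` under
the level-0 window: `T4IndicatorShell.ShellWeightBound` for the region-indexed term families with the explicit, finitely
supported `Wsh K = #(C K)·(W^A ρ^A₀ + W^B ρ^B₀)`.  NOT NE7c: no live level `j ≥ 1` is present (T-NE7c-3); (M1)₀ and the
closeness are hypotheses. [folklore] -/
theorem shellWeightBound_levelZero_window {μA μB : ∀ K : ℕ, ℝ → Measure (Ω K)} [∀ K t, IsFiniteMeasure (μA K t)]
    [∀ K t, IsFiniteMeasure (μB K t)] {uA uB : ∀ K : ℕ, ℝ → σ → Ω K → ℝ} {θA ρA θB ρB : ℕ → ℝ}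
    {DslotA DslotB : ℕ → σ → ℝ} (huA : ∀ K t s, Measurable (uA K t s)) (huB : ∀ K t s, Measurable (uB K t s))
    (hcloseA : ∀ K t, |t| ≤ l₀ → ∀ s ∈ C K, ∀ᵐ ω ∂(μA K t), |uA K t s ω - uB K t s ω| ≤ ρA 0 * θA 0)
    (hcloseB : ∀ K t, |t| ≤ l₀ → ∀ s ∈ C K, ∀ᵐ ω ∂(μB K t), |uB K t s ω - uA K t s ω| ≤ ρB 0 * θB 0)
    (hρA : ∀ j, 0 ≤ ρA j) (hρB : ∀ j, 0 ≤ ρB j) (hDsA : ∀ K, ∀ s ∈ C K, 0 ≤ DslotA K s)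
    (hDsB : ∀ K, ∀ s ∈ C K, 0 ≤ DslotB K s) (hwin : ∀ K, ∀ s ∈ C K, K ≤ N₁)
    (hacA : ∀ K t, |t| ≤ l₀ → ∀ s ∈ C K, SlotAntiConcentration (μA K t) (uA K t s) (θA 0) (ρA 0) (DslotA K s))
    (hacB : ∀ K t, |t| ≤ l₀ → ∀ s ∈ C K, SlotAntiConcentration (μB K t) (uB K t s) (θB 0) (ρB 0) (DslotB K s)) :
    ShellWeightBound l₀ (fun K => (C K).powerset)
      (fun K t => regionWeight (C K) (μA K t) (uA K t) (θA 0)) (fun K t => regionWeight (C K) (μB K t) (uB K t) (θB 0))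
      (fun K t => regionShell (C K) (μA K t) (uA K t) (uB K t) (θA 0))
      (fun K t => regionShell (C K) (μB K t) (uB K t) (uA K t) (θB 0))
      (fun K => (C K).card * ((∑ K' ∈ Finset.range (N₁ + 1), ∑ s' ∈ C K', DslotA K' s') * ρA 0) +
        (C K).card * ((∑ K' ∈ Finset.range (N₁ + 1), ∑ s' ∈ C K', DslotB K' s') * ρB 0)) := by
  have hA := levelLedger_levelZero_cubes_window huA huB hcloseA hρA hDsA hwin hacA
  have hB := levelLedger_levelZero_cubes_window huB huA hcloseB hρB hDsB hwin hacB
  have h := shellWeightBound_of_slotLedger_window hA.toSlotLedger hB.toSlotLedger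
    (fun K hK => omega_levelZero_cubes_window_eq_zero huA huB hcloseA hρA hDsA hwin hacA hK)
    (fun K hK => omega_levelZero_cubes_window_eq_zero huB huA hcloseB hρB hDsB hwin hacB hK)
  have hW : (fun K => hA.toSlotLedger.omega K + hB.toSlotLedger.omega K) =
      (fun K => (C K).card * ((∑ K' ∈ Finset.range (N₁ + 1), ∑ s' ∈ C K', DslotA K' s') * ρA 0) +
        (C K).card * ((∑ K' ∈ Finset.range (N₁ + 1), ∑ s' ∈ C K', DslotB K' s') * ρB 0)) := by
    funext K
    rw [omega_levelZero_cubes_window huA huB hcloseA hρA hDsA hwin hacA K,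
      omega_levelZero_cubes_window huB huA hcloseB hρB hDsB hwin hacB K]
  exact hW ▸ h

end LevelZero

/-! ## §3 The realized `SU(2)` level-0 family ledger with `hD` discharged -/

section Realized

variable (P : ℕ → Params) (jl : ℕ → ℕ) [∀ K, DecidableEq (PBond (P K) (jl K))] [∀ K, DecidableEq (Plaq (P K) (jl K))]
  {σ₀ : Type*} [DecidableEq σ₀]

/-- **ROW S19 FILE 3 WITHOUT `hD`: THE LEVEL-0 ONE-RUN LEDGER OVER THE CUTOFF-INDEXED LATTICE FAMILY UNDER END-I's
WINDOW.**  Hypotheses = `ShellMeasureWilsonLedgerFamily.levelLedger_wilson_su2_levelZero_family`'s VERBATIM (row S1's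
geometry∕numerics per cutoff `K` on the lattice `P K`, bare coupling `β K ≥ 0`, chart window `S K`, co-test threshold
`σc K ≥ θ 0`, bounded source `|Fobs K| ≤ w`, the other run's measurable tested variables and the per-cube a.e.
closeness `|wilsonU − u^B| ≤ ρ₀θ₀` — node U1b TYPE at level 0 —, signs) EXCEPT that the cutoff-uniformity binder
`hD : ∀ K s, D_{K,s} ≤ D 0` and `hD0` are GONE and the level-0 window `hwin : ∀ K, ∀ s ∈ C K, K ≤ N₁` (END-I's
`LiveWindow.recent` at `lvl ≡ 0`, §1 `window_of_liveWindow`) is added.  CONCLUSION: END-I's one-run `LevelLedger` in its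
literal `K`-indexed shape, (M1)₀ discharged per `(K, s)` by row S19 file 2's `slotAntiConcentration_wilson_su2_gibbs_source`,
level constant THE WINDOW SUM `Σ_{K ≤ N₁} Σ_{s ∈ C K} 2(n_{K,s} + β_K·Σ_{P_w(K,s)} 8S_K(8+32S_K))∕(1−δ)·e^{2l₀w}`.
NOT NE7c; nothing printed asserted. [folklore] -/
theorem levelLedger_wilson_su2_levelZero_family_window
    (lo hi : ∀ K, σ₀ → Fin (P K).d → ℤ) (m : ℕ → σ₀ → ℕ)
    (hN : ∀ K s κ, hi K s κ - lo K s κ < (P K).sitesPerDir (jl K)) (hm : ∀ K s κ, hi K s κ ≤ lo K s κ + m K s)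
    (Λ : ∀ K, σ₀ → Finset (PBond (P K) (jl K))) (hΛbox : ∀ K s, ∀ b ∈ Λ K s, b ∈ boxBonds (lo K s) (hi K s))
    (hΛcomb : ∀ K s, Disjoint (Λ K s) (combBonds (lo K s) (hi K s)))
    (hcov : ∀ K s, ∀ b ∈ boxBonds (lo K s) (hi K s), b ∉ Λ K s →
      b ∈ (combBonds (lo K s) (hi K s) : Finset (PBond (P K) (jl K))))
    (n : ℕ → σ₀ → ℕ) (e : ∀ K s, ↥(Λ K s) × Fin 3 ≃ Fin (n K s))
    (S σc : ℕ → ℝ) (hS : ∀ K, 0 < S K) (hS8 : ∀ K, S K ≤ 1 / 8) (hSπ : ∀ K, 3 * S K ^ 2 < Real.pi ^ 2)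
    (hσ : ∀ K, 0 < σc K) (hrad : ∀ K s, (((P K).d - 1 : ℕ) : ℝ) * m K s * σc K ≤ 2 * S K / Real.pi)
    (Pu : ∀ K, σ₀ → Finset (Plaq (P K) (jl K))) (hPu : ∀ K s, (Pu K s).Nonempty)
    (hPubox : ∀ K s, ∀ p ∈ Pu K s, p ∈ boxPlaqs (lo K s) (hi K s))
    (hboxPu : ∀ K s, boxPlaqs (lo K s) (hi K s) ⊆ (↑(Pu K s) : Set (Plaq (P K) (jl K))))
    (Pw Pext : ∀ K, σ₀ → Finset (Plaq (P K) (jl K))) (Pall : ∀ K, Finset (Plaq (P K) (jl K)))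
    (β : ℕ → ℝ) {δ : ℝ} {θ ρ : ℕ → ℝ} (hβ : ∀ K, 0 ≤ β K) (hθ : 0 < θ 0) (hθσ : ∀ K, θ 0 ≤ σc K) (hδ0 : 0 ≤ δ)
    (hδ1 : δ < 1) (hρ0 : ∀ i, 0 ≤ ρ i) (hρ : ρ 0 ≤ (1 - δ) / 2)
    (hSM : ∀ K, 4 * (8 * S K) ^ 2 * Real.exp (2 * (8 * S K)) ≤ δ * θ 0)
    (hSMσ : ∀ K, 4 * (8 * S K) ^ 2 * Real.exp (2 * (8 * S K)) ≤ δ * σc K)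
    (hPext : ∀ K s, ∀ p ∈ Pext K s, (⟨p.src, p.μ⟩ : PBond (P K) (jl K)) ∉ Λ K s ∧
      (⟨p.src.shift p.μ, p.ν⟩ : PBond (P K) (jl K)) ∉ Λ K s ∧ (⟨p.src.shift p.ν, p.μ⟩ : PBond (P K) (jl K)) ∉ Λ K s ∧
      (⟨p.src, p.ν⟩ : PBond (P K) (jl K)) ∉ Λ K s)
    (hdisj : ∀ K s, Disjoint (Pext K s) (Pw K s)) (hall : ∀ K s, Pext K s ∪ Pw K s = Pall K)
    (Fobs : ∀ K, GaugeField (P K) (jl K) SU2 → ℝ) {w l₀ : ℝ} (hw : 0 ≤ w) (hFw : ∀ K U, |Fobs K U| ≤ w)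
    (C : ℕ → Finset σ₀) {N₁ : ℕ} (hwin : ∀ K, ∀ s ∈ C K, K ≤ N₁)
    (uB : ∀ K : ℕ, ℝ → σ₀ → GaugeField (P K) (jl K) SU2 → ℝ)
    (huB : ∀ K t s, Measurable (uB K t s))
    (hclose : ∀ K t, |t| ≤ l₀ → ∀ s ∈ C K,
      ∀ᵐ U ∂((fieldMeasure (P K) (jl K) SU2).withDensity fun U => ENNReal.ofReal (Real.exp (t * Fobs K U)) *
        ENNReal.ofReal (Real.exp (-(β K * ∑ p ∈ Pall K, (1 - reTr (GaugeField.plaqHol U p)))))),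
        |wilsonU (hPu K s) U - uB K t s U| ≤ ρ 0 * θ 0) :
    LevelLedger l₀ (fun K => (C K).powerset)
      (fun K t => regionWeight (C K)
        ((fieldMeasure (P K) (jl K) SU2).withDensity fun U => ENNReal.ofReal (Real.exp (t * Fobs K U)) *
          ENNReal.ofReal (Real.exp (-(β K * ∑ p ∈ Pall K, (1 - reTr (GaugeField.plaqHol U p))))))
        (fun s => wilsonU (hPu K s)) (θ 0))
      (fun K t => regionShell (C K)
        ((fieldMeasure (P K) (jl K) SU2).withDensity fun U => ENNReal.ofReal (Real.exp (t * Fobs K U)) *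
          ENNReal.ofReal (Real.exp (-(β K * ∑ p ∈ Pall K, (1 - reTr (GaugeField.plaqHol U p))))))
        (fun s => wilsonU (hPu K s)) (uB K t) (θ 0))
      C
      (fun K t => regionPiece (C K)
        ((fieldMeasure (P K) (jl K) SU2).withDensity fun U => ENNReal.ofReal (Real.exp (t * Fobs K U)) *
          ENNReal.ofReal (Real.exp (-(β K * ∑ p ∈ Pall K, (1 - reTr (GaugeField.plaqHol U p))))))
        (fun s => wilsonU (hPu K s)) (uB K t) (θ 0))
      (fun _ _ => 0)
      (fun _ => ∑ K' ∈ Finset.range (N₁ + 1), ∑ s' ∈ C K',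
        2 * ((n K' s' : ℝ) + β K' * ∑ _p ∈ Pw K' s', (8 * S K') * (8 + 4 * (8 * S K'))) / (1 - δ) *
          Real.exp (2 * l₀ * w)) ρ := by
  -- every tilted Gibbs law is a finite measure (row S19 file 3's argument, verbatim)
  haveI : ∀ (K : ℕ) (t : ℝ), IsFiniteMeasure ((fieldMeasure (P K) (jl K) SU2).withDensity fun U =>
      ENNReal.ofReal (Real.exp (t * Fobs K U)) *
        ENNReal.ofReal (Real.exp (-(β K * ∑ p ∈ Pall K, (1 - reTr (GaugeField.plaqHol U p)))))) := fun K t => by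
    refine isFiniteMeasure_withDensity (ne_top_of_le_ne_top ?_ (lintegral_mono (g := fun _ =>
      ENNReal.ofReal (Real.exp (|t| * w))) fun U => ?_))
    · rw [lintegral_const]; exact ENNReal.mul_ne_top ENNReal.ofReal_ne_top (measure_ne_top _ _)
    · calc ENNReal.ofReal (Real.exp (t * Fobs K U)) *
            ENNReal.ofReal (Real.exp (-(β K * ∑ p ∈ Pall K, (1 - reTr (GaugeField.plaqHol U p)))))
          ≤ ENNReal.ofReal (Real.exp (|t| * w)) * 1 := by
            refine mul_le_mul' (ENNReal.ofReal_le_ofReal (Real.exp_le_exp.2 ?_)) ?_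
            · calc t * Fobs K U ≤ |t * Fobs K U| := le_abs_self _
                _ = |t| * |Fobs K U| := abs_mul _ _
                _ ≤ |t| * w := mul_le_mul_of_nonneg_left (hFw K U) (abs_nonneg t)
            · rw [ENNReal.ofReal_le_one, Real.exp_le_one_iff, neg_nonpos]
              exact mul_nonneg (hβ K) (wilsonSum_nonneg (Pall K) U)
        _ = ENNReal.ofReal (Real.exp (|t| * w)) := mul_one _
  have h1δ : 0 < 1 - δ := by linarith
  -- the per-(K, s) constants of row S19 file 2 are nonnegative
  have hDs : ∀ K, ∀ s ∈ C K, 0 ≤ 2 * ((n K s : ℝ) + β K * ∑ _p ∈ Pw K s, (8 * S K) * (8 + 4 * (8 * S K))) / (1 - δ) *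
      Real.exp (2 * l₀ * w) := fun K s _ => by
    have hSK := hS K
    exact mul_nonneg (div_nonneg (mul_nonneg zero_le_two (add_nonneg (Nat.cast_nonneg _)
      (mul_nonneg (hβ K) (Finset.sum_nonneg fun _ _ => by positivity)))) h1δ.le) (Real.exp_nonneg _)
  exact levelLedger_levelZero_cubes_window
    (μ := fun K t => (fieldMeasure (P K) (jl K) SU2).withDensity fun U => ENNReal.ofReal (Real.exp (t * Fobs K U)) *
      ENNReal.ofReal (Real.exp (-(β K * ∑ p ∈ Pall K, (1 - reTr (GaugeField.plaqHol U p))))))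
    (uA := fun K _ s => wilsonU (hPu K s))
    (Dslot := fun K s => 2 * ((n K s : ℝ) + β K * ∑ _p ∈ Pw K s, (8 * S K) * (8 + 4 * (8 * S K))) / (1 - δ) *
      Real.exp (2 * l₀ * w))
    (fun K _ s => measurable_wilsonU (hPu K s)) huB hclose hρ0 hDs hwin
    (fun K t ht s _ => slotAntiConcentration_wilson_su2_gibbs_source (hN K s) (hm K s) (Λ K s) (hΛbox K s)
      (hΛcomb K s) (hcov K s) (e K s) (hS K) (hS8 K) (hSπ K) (hσ K) (hrad K s) (hPu K s) (hPubox K s) (hboxPu K s)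
      (Pw K s) (Pext K s) (Pall K) (hβ K) hθ (hθσ K) hδ0 hδ1 (hρ0 0) hρ (hSM K) (hSMσ K) (hPext K s) (hdisj K s)
      (hall K s) hw (hFw K) ht)

end Realized

end Summit.QuantumFields.BalabanUV.T4Continuum.ShellMeasureWilsonLedgerWindow

end
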